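import Literature.Geometry.Riemannian.SphericalCylinderEntropy
import HarnessLib

/-!
# Route `CylinderEntropy`, crux `CylinderRungTwo` (stmt-SmoothPoincare4-7631), line `killing-flux`:
# atomic quantization of the height marginal (registered helper `helper_atomicQuantization`,
# plan r10 step S8)

Let `μ` be a finite measure on `ℝ⁶` carried by the round cylinder `N = {z | ∑_{i<5} zᵢ² = 1}`, write
`V = μH⁴(S⁴)` (`0 < V < ⊤`, tree `SphericalCylinderEntropy.hausdorffMeasure_sphere_four_pos/_lt_top`),
`slice c = {z | z₅ = c}` and `ratio(x, r) = μ(B(x, r)) / μH⁴(B⁴(0, r))`.  Assume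

* (HYP 1) at every `x ∈ N`, `ratio(x, ·) → μ(slice x₅) / V` as `r ↓ 0`;
* (HYP 2) at `μ`-a.e. `x`, `ratio(x, ·) → N_x` as `r ↓ 0` for some positive integer `N_x`.

Then `μ(ℝ⁶) = m · V` for some `m : ℕ`.

Proof.  (1) For `μ`-a.e. `x` both limits exist along the non-trivial filter `𝓝[>] 0`, so
`μ(slice x₅) = N_x · V ≥ V` (`tendsto_nhds_unique`).  (2) The set `D` of heights `c` with `μ(slice c) ≥ V`
is finite: distinct slices are disjoint, so `card T · V ≤ μ(⋃_{c ∈ T} slice c) ≤ μ(ℝ⁶) < ⊤` for every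
finset `T ⊆ D`, while an infinite `D` contains finsets of every cardinality.  (3) By (1), `x₅ ∈ D` for
`μ`-a.e. `x`, so `μ(ℝ⁶) = μ(⋃_{c ∈ D} slice c) = ∑_{c ∈ D} μ(slice c)`.  (4) Each heavy slice is not
`μ`-null, hence meets the full-measure set of (1): `μ(slice c) = N_c · V` with `N_c : ℕ`.  Summing,
`m = ∑_{c ∈ D} N_c`.

Everything here is PROVED (no `sorry`, no new definitions, no named facts).
-/

-- the prescribed namespace `Summit.SmoothPoincare4.SmoothPoincare4.…` repeats `SmoothPoincare4`
set_option linter.dupNamespace false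

noncomputable section

open MeasureTheory Set Filter
open scoped Manifold ContDiff ENNReal NNReal Topology BigOperators

namespace Summit.SmoothPoincare4.SmoothPoincare4.Cruxes.CylinderRungTwo.KillingFlux

open Literature.Geometry.Riemannian.SphericalCylinderEntropy (hausdorffMeasure_sphere_four_pos
  hausdorffMeasure_sphere_four_lt_top)

namespace AtomicQuantization

/-! ## Height slices of `ℝ⁶` -/

/-- The height slice `{z | z₅ = c}` of `ℝ⁶` is measurable (it is closed). [folklore] -/
theorem measurableSet_slice (c : ℝ) :
    MeasurableSet {z : EuclideanSpace ℝ (Fin 6) | z 5 = c} :=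
  (isClosed_eq (PiLp.continuous_apply 2 _ 5) continuous_const).measurableSet

/-- Height slices of distinct heights are disjoint. [folklore] -/
theorem pairwiseDisjoint_slice (T : Set ℝ) :
    T.PairwiseDisjoint (fun c => {z : EuclideanSpace ℝ (Fin 6) | z 5 = c}) := by
  intro c _ c' _ hne
  refine Set.disjoint_left.2 fun z hz hz' => hne ?_
  rw [Set.mem_setOf_eq] at hz hz'
  rw [← hz, ← hz']

/-- If every slice over a finset `T` of heights carries mass `≥ V`, then `card T · V ≤ μ(ℝ⁶)` (the slices
are disjoint). [folklore] -/
theorem card_mul_le_measure_univ (μ : Measure (EuclideanSpace ℝ (Fin 6))) (V : ℝ≥0∞) (T : Finset ℝ)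
    (hT : ∀ c ∈ T, V ≤ μ {z : EuclideanSpace ℝ (Fin 6) | z 5 = c}) :
    (T.card : ℝ≥0∞) * V ≤ μ Set.univ :=
  calc (T.card : ℝ≥0∞) * V = ∑ _c ∈ T, V := by rw [Finset.sum_const, nsmul_eq_mul]
    _ ≤ ∑ c ∈ T, μ {z : EuclideanSpace ℝ (Fin 6) | z 5 = c} := Finset.sum_le_sum hT
    _ = μ (⋃ c ∈ T, {z : EuclideanSpace ℝ (Fin 6) | z 5 = c}) :=
        (measure_biUnion_finset (pairwiseDisjoint_slice _) fun c _ => measurableSet_slice c).symm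
    _ ≤ μ Set.univ := measure_mono (Set.subset_univ _)

/-- For a finite measure on `ℝ⁶` and `V ≠ 0`, only finitely many height slices carry mass `≥ V`.
[folklore] -/
theorem finite_heavySlices (μ : Measure (EuclideanSpace ℝ (Fin 6))) [IsFiniteMeasure μ] {V : ℝ≥0∞}
    (hV : V ≠ 0) : {c : ℝ | V ≤ μ {z : EuclideanSpace ℝ (Fin 6) | z 5 = c}}.Finite := by
  by_contra hinf
  obtain ⟨n, hn⟩ := ENNReal.exists_nat_mul_gt hV (measure_ne_top μ Set.univ)
  obtain ⟨T, hTsub, hTcard⟩ := Set.Infinite.exists_subset_card_eq hinf n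
  have h := card_mul_le_measure_univ μ V T fun c hc => hTsub (Finset.mem_coe.2 hc)
  rw [hTcard] at h
  exact absurd hn (not_lt.2 h)

end AtomicQuantization

open AtomicQuantization

/-- **Registered helper `helper_atomicQuantization` of line `killing-flux` (plan r10 step S8: atomic
quantization).**  If a finite measure `μ` on `ℝ⁶` carried by `N = S⁴ × ℝ` has, at every `x ∈ N`, the
`4`-density `μ(slice x₅)/μH⁴(S⁴)`, and at `μ`-a.e. `x` a positive integer `4`-density, then
`μ(ℝ⁶) = m · μH⁴(S⁴)` for some `m : ℕ` (uniqueness of limits along `𝓝[>] 0` makes a.e. slice mass a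
positive integer multiple of `V = μH⁴(S⁴)`; the heights of mass `≥ V` form a finite set carrying `μ`; sum).
[folklore] -/
theorem helper_atomicQuantization : ∀ (μ : Measure (EuclideanSpace ℝ (Fin 6))) [IsFiniteMeasure μ], μ {z : EuclideanSpace ℝ (Fin 6) | ¬ (∑ i : Fin 5, z (Fin.castSucc i) ^ 2 = 1)} = 0 → (∀ x : EuclideanSpace ℝ (Fin 6), ∑ i : Fin 5, x (Fin.castSucc i) ^ 2 = 1 → Filter.Tendsto (fun r : ℝ => μ (Metric.ball x r) / μH[4] (Metric.ball (0 : EuclideanSpace ℝ (Fin 4)) r)) (𝓝[>] 0) (𝓝 (μ {z : EuclideanSpace ℝ (Fin 6) | z 5 = x 5} / μH[4] (Metric.sphere (0 : EuclideanSpace ℝ (Fin 5)) 1)))) → (∀ᵐ x ∂μ, ∃ N : ℕ, 0 < N ∧ Filter.Tendsto (fun r : ℝ => μ (Metric.ball x r) / μH[4] (Metric.ball (0 : EuclideanSpace ℝ (Fin 4)) r)) (𝓝[>] 0) (𝓝 (N : ℝ≥0∞))) → ∃ m : ℕ, μ Set.univ = m * μH[4] (Metric.sphere (0 : EuclideanSpace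 ℝ (Fin 5)) 1) := by
  intro μ _ hcar hdens hint
  set V : ℝ≥0∞ := μH[4] (Metric.sphere (0 : EuclideanSpace ℝ (Fin 5)) 1) with hV
  have hV0 : V ≠ 0 := hausdorffMeasure_sphere_four_pos.ne'
  have hVt : V ≠ ⊤ := hausdorffMeasure_sphere_four_lt_top.ne
  -- Step 1: a.e. the slice mass is a positive integer multiple of `V`
  have hQ : ∀ᵐ x ∂μ, ∃ N : ℕ, 0 < N ∧ μ {z : EuclideanSpace ℝ (Fin 6) | z 5 = x 5} = N * V := by
    have hN : ∀ᵐ x ∂μ, ∑ i : Fin 5, x (Fin.castSucc i) ^ 2 = 1 := ae_iff.2 hcar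
    filter_upwards [hN, hint] with x hx ⟨N, hNpos, hT⟩
    refine ⟨N, hNpos, ?_⟩
    have huniq := tendsto_nhds_unique (hdens x hx) hT
    rw [← (ENNReal.eq_div_iff hV0 hVt).1 huniq.symm, mul_comm]
  -- Step 2: the heavy heights form a finite set `D`
  set D : Set ℝ := {c : ℝ | V ≤ μ {z : EuclideanSpace ℝ (Fin 6) | z 5 = c}} with hD
  have hDfin : D.Finite := finite_heavySlices μ hV0
  -- Step 3: `μ` is carried by the slices over `D`
  have hmem : ∀ᵐ x ∂μ, x 5 ∈ D := by
    filter_upwards [hQ] with x ⟨N, hNpos, hNx⟩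
    show V ≤ μ {z : EuclideanSpace ℝ (Fin 6) | z 5 = x 5}
    rw [hNx]
    calc V = 1 * V := (one_mul V).symm
      _ ≤ N * V := mul_le_mul_left (Nat.one_le_cast.2 hNpos) V
  -- Step 4: each heavy slice has mass in `ℕ · V`
  have hatom : ∀ c ∈ D, ∃ N : ℕ, μ {z : EuclideanSpace ℝ (Fin 6) | z 5 = c} = N * V := by
    intro c hc
    by_contra hno
    push Not at hno
    have hnull : μ {z : EuclideanSpace ℝ (Fin 6) | z 5 = c} = 0 := by
      refine measure_mono_null ?_ (ae_iff.1 hQ)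
      intro z hz
      simp only [Set.mem_setOf_eq] at hz ⊢
      rintro ⟨N, -, hNz⟩
      rw [hz] at hNz
      exact hno N hNz
    have hle : V ≤ 0 := by
      have hc' : V ≤ μ {z : EuclideanSpace ℝ (Fin 6) | z 5 = c} := hc
      rwa [hnull] at hc'
    exact hV0 (le_zero_iff.1 hle)
  choose! Nc hNc using hatom
  -- Step 5: sum
  refine ⟨∑ c ∈ hDfin.toFinset, Nc c, ?_⟩
  have hunion : {x : EuclideanSpace ℝ (Fin 6) | x 5 ∈ D} =
      ⋃ c ∈ hDfin.toFinset, {z : EuclideanSpace ℝ (Fin 6) | z 5 = c} := by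
    ext x
    simp only [Set.mem_setOf_eq, Set.mem_iUnion, Set.Finite.mem_toFinset, exists_prop, exists_eq_right']
  calc μ Set.univ = μ {x : EuclideanSpace ℝ (Fin 6) | x 5 ∈ D} :=
        (measure_congr (Filter.eventuallyEq_univ.2 hmem)).symm
    _ = ∑ c ∈ hDfin.toFinset, μ {z : EuclideanSpace ℝ (Fin 6) | z 5 = c} := by
        rw [hunion]
        exact measure_biUnion_finset (pairwiseDisjoint_slice _) fun c _ => measurableSet_slice c
    _ = ∑ c ∈ hDfin.toFinset, (Nc c : ℝ≥0∞) * V :=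
        Finset.sum_congr rfl fun c hc => hNc c (hDfin.mem_toFinset.1 hc)
    _ = ((∑ c ∈ hDfin.toFinset, Nc c : ℕ) : ℝ≥0∞) * V := by rw [Nat.cast_sum, Finset.sum_mul]

end Summit.SmoothPoincare4.SmoothPoincare4.Cruxes.CylinderRungTwo.KillingFlux

end
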